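import Literature.MathematicalPhysics.QuantumLattice.FermionGammaDerivative
import HarnessLib

/-!
# Stub `stub_Gamma_deriv` of line `pin-the-infimum` (crux `RobustYangMillsHandover`, item 8892)

E2-c of the fermionic-insertion bricks in Lüscher's transfer-matrix representation of the QCD torus
functional: a quark bilinear inserted at one time slice is the source derivative of a one-step matrix
`M_t(s) = M_t (1 + s Y_t)`, and `d/ds|₀ Γ(M_t(s)) = Γ(M_t) dΓ(Y_t)` turns it into the explicit Fock operator
`Γ(M_t) · dΓ(Y_t)`, `dΓ(Y) = Σᵢⱼ Yᵢⱼ c†ᵢ cⱼ` (the second quantisation of the one-particle matrix `Y`), between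
the transfer matrices. Here `Γ = Gamma` is the tree's second-quantisation functor (matrix of minors,
`Literature/MathematicalPhysics/QuantumLattice/FermionGammaFunctor.lean`) on the Jordan–Wigner Fock space
`Fock ι = Finset ι → ℂ`, and the statement is ENTRYWISE (scalar `HasDerivAt`), so no matrix norm is chosen.
It is the tree theorem `Literature.MathematicalPhysics.QuantumLattice.hasDerivAt_Gamma_mul_one_add_smul_apply`
(`FermionGammaDerivative.lean`: path independence of the derivative of the minors + `Γ(e^{sY}) = e^{s dΓ(Y)}`
+ functoriality `Γ(g(1 + sY)) = Γ(g) Γ(1 + sY)`), with `dGamma Y` unfolded.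
-/

open Matrix Literature.MathematicalPhysics.QuantumLattice

namespace Summit.QuantumFields.QCD.Cruxes.RobustYangMillsHandover.PinTheInfimum

/-- **E2-c: the derivative of the Fock functor at `g` in the direction `gY` is `Γ(g)·dΓ(Y)`** (entrywise):
for all one-body matrices `g, Y : Matrix ι ι ℂ` and all `S, T : Finset ι`,
`d/ds|₀ ⟨S| Γ(g(1 + sY)) |T⟩ = ⟨S| Γ(g) · Σᵢⱼ Yᵢⱼ c†ᵢ cⱼ |T⟩`
(Dereziński–Gérard, *Mathematics of Quantization and Quantum Fields*, Prop. 3.23 (1); Bratteli–Robinson II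
§5.2.1; `Literature.MathematicalPhysics.QuantumLattice.hasDerivAt_Gamma_mul_one_add_smul_apply`).
The statement is the registered stub signature verbatim. -/
theorem stub_Gamma_deriv :
    ∀ (ι : Type) [LinearOrder ι] [Fintype ι] (g Y : Matrix ι ι ℂ) (S T : Finset ι),
      HasDerivAt (fun s : ℝ => Gamma (g * (1 + (s : ℂ) • Y)) S T)
        ((Gamma g * ∑ i : ι, ∑ j : ι, Y i j • (creation i * annihilation j)) S T) 0 := by
  intro ι _ _ g Y S T
  exact hasDerivAt_Gamma_mul_one_add_smul_apply g Y S T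

end Summit.QuantumFields.QCD.Cruxes.RobustYangMillsHandover.PinTheInfimum
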